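import Mathlib
import Literature.AlgebraicGeometry.Resolution.AdicQuotient
import Literature.AlgebraicGeometry.Motives.SubschemeCyclesDimProofs
import HarnessLib

/-!
# `TeissierResolve`, line `Sketch` (toric normalisation + destackification): `k`-linearisation

Route `ResolutionOfSingularities/TeissierJung`, crux `TeissierResolve`
(stmt-ResolutionOfSingularities-17086), stub `stub_kLinearisation` of the lead's skeleton,
PROVED here (statement verbatim from the ledger registration).

**Statement.** Let `k` be an algebraically closed field of characteristic `p > 0`, `X` a scheme
locally of finite type (and quasi-compact) over `k`, `x ∈ X` a CLOSED point. Let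
`S = k[y₁, …, y_d]` be graded by a finite abelian group `A` through weights `deg : Fin d → A`,
`S₀` its degree-`0` part (a simplicial toric ring) and `𝔪₀ = ker (constantCoeff|_{S₀})` its
irrelevant ideal. If there is a RING isomorphism `E₁ : 𝒪̂_{X,x} ≃ (S₀)^_{𝔪₀}`, then there is one,
`E₂`, compatible with the two `k`-structures (`k → 𝒪_{X,x} → 𝒪̂_{X,x}` and `k → S₀ → (S₀)^`).

**Proof.** Put `Ô = 𝒪̂_{X,x}` (a complete Noetherian local ring: `X` is locally Noetherian),
`𝒞 = (S₀)^_{𝔪₀}`, `f₁ : k → Ô` the structure map and `f₂ = E₁⁻¹ ∘ ι_𝒞 : k → Ô`.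
1. *Both `f₁(k)` and `f₂(k)` map onto the residue field of `Ô`.* For `f₁`: the residue field of
   `Ô` is that of `𝒪_{X,x}` (`AdicCompletion.residueField_map_bijective`), i.e. `κ(x)`, and
   `k → κ(x)` is onto for a closed point of a scheme locally of finite type over an algebraically
   closed field (Hilbert's Nullstellensatz, Mathlib `residueFieldIsoBase`; the identification of
   the structure map with `k = Γ(Spec k) → Γ(X) → κ(x)` is the tree lemma
   `SpecMap_ΓSpecIso_inv_appTop_Γevaluation` of `Literature.AlgebraicGeometry.Motives.Scheme`).
   For `f₂`: every element of `𝒞` is congruent to a scalar modulo `𝔑 = ker (𝒞 → S₀/𝔪₀)`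
   (take the constant coefficient of a lift), `𝔑` is a proper ideal, so its elements are
   non-units, and `E₁⁻¹` carries non-units into the maximal ideal of the local ring `Ô`.
2. *Uniqueness of the perfect coefficient field* (`range_subset_range_of_forall_sub_mem`,
   Matsumura Thm. 28.3 (iv) for the `0`-étale extension `k/𝔽ₚ`; here by the elementary Frobenius
   argument): in a ring `L` of characteristic `p` with an ideal `N ≠ ⊤` such that
   `⋂ₙ Nⁿ = 0`, two copies `f₁(k), f₂(k)` of a perfect field with `f₁(k) ⊆ f₂(k) + N` satisfy
   `f₁(k) ⊆ f₂(k)`: write `a = bₙ^{pⁿ}`, `bₙ ≡ b'ₙ (mod N)` with `b'ₙ ∈ f₂(k)`; then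
   `a - b'ₙ^{pⁿ} = (bₙ - b'ₙ)^{pⁿ} ∈ N^{pⁿ}`, the `b'ₙ^{pⁿ} ∈ f₂(k)` are congruent mod `N` hence
   EQUAL (`f₂(k) ∩ N = 0`), so `a - b'₀ ∈ ⋂ N^{pⁿ} = 0`. Hence `f₁(k) = f₂(k)` in `Ô`
   (`Ô` is `𝔪̂`-adically separated), i.e. `E₁ ∘ f₁ = ι_𝒞 ∘ τ` for a ring automorphism `τ` of `k`.
3. *The twist.* `MvPolynomial.map τ⁻¹` preserves weighted-homogeneous components and constant
   coefficients, so it restricts to a ring automorphism `Ψ₀` of `S₀` with `Ψ₀(𝔪₀) = 𝔪₀` and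
   `Ψ₀(c) = τ⁻¹(c)` on scalars; it extends to `Ψ̂ : 𝒞 ≃ 𝒞` (`adicCompletionCongr` of
   `Literature.AlgebraicGeometry.Resolution`, file `AdicQuotient.lean`), and `E₂ = Ψ̂ ∘ E₁` is
   `k`-linear: `E₂(f₁ a) = Ψ̂(ι_𝒞(τ a)) = ι_𝒞(τ⁻¹ τ a) = ι_𝒞(a)`.

Sources: H. Matsumura, *Commutative Ring Theory* (1986), §28, Thm. 28.3 (iv) (uniqueness of the
coefficient field containing a quasi-coefficient field); I. S. Cohen, Trans. AMS 59 (1946).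
Everything here is [folklore]; no definitions, no named facts.
-/

noncomputable section

set_option linter.dupNamespace false -- mandated namespace of this single-conjunct summit

open CategoryTheory AlgebraicGeometry TopologicalSpace IsLocalRing
open Literature.AlgebraicGeometry.Resolution

namespace Summit.ResolutionOfSingularities.ResolutionOfSingularities.Theorems.TeissierResolve.KLinearisation

attribute [local instance] MvPolynomial.weightedGradedAlgebra

/-! ## Uniqueness of a perfect coefficient field (Frobenius argument) -/

/-- **Uniqueness of the perfect coefficient field, one inclusion.** Let `L` be a commutative ring,
`N ≠ ⊤` an ideal with `⋂ₙ Nⁿ = 0`, and `f₁, f₂ : k → L` two ring homomorphisms from a perfect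
field `k` of characteristic `p` such that every `f₁ a` is congruent modulo `N` to some `f₂ b`.
Then `f₁(k) ⊆ f₂(k)`. (Write `a = bₙ^{pⁿ}`; if `f₁ bₙ ≡ f₂ b'ₙ (mod N)` then
`f₁ a - f₂ (b'ₙ^{pⁿ}) = (f₁ bₙ - f₂ b'ₙ)^{pⁿ} ∈ N^{pⁿ}`; the elements `f₂ (b'ₙ^{pⁿ})` are
congruent modulo `N`, hence equal since `f₂(k) ∩ N = 0`, so `f₁ a - f₂ (b'₀) ∈ ⋂ₙ N^{pⁿ} = 0`.)
Matsumura, *Commutative Ring Theory*, Thm. 28.3 (iv) is the classical form. [folklore] -/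
theorem range_subset_range_of_forall_sub_mem {p : ℕ} [Fact p.Prime] {k L : Type*} [Field k]
    [CharP k p] [PerfectRing k p] [CommRing L] (N : Ideal L) (hN : N ≠ ⊤)
    (hhaus : ∀ x : L, (∀ n : ℕ, x ∈ N ^ n) → x = 0) (f₁ f₂ : k →+* L)
    (h : ∀ a : k, ∃ b : k, f₁ a - f₂ b ∈ N) : Set.range f₁ ⊆ Set.range f₂ := by
  rintro _ ⟨α, rfl⟩
  haveI : Nontrivial L :=
    nontrivial_of_ne 1 0 fun h10 => hN ((Ideal.eq_top_iff_one N).mpr (h10 ▸ N.zero_mem))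
  haveI : ExpChar L p := expChar_of_injective_ringHom f₂.injective p
  -- `f₂(k) ∩ N = 0`
  have hinj : ∀ δ : k, f₂ δ ∈ N → δ = 0 := fun δ hδ => by
    by_contra hne
    exact hN (Ideal.eq_top_of_isUnit_mem N hδ ((isUnit_iff_ne_zero.mpr hne).map f₂))
  -- approximants `f₂ (γ n ^ p ^ n)` of `f₁ α` modulo `N ^ p ^ n`
  have step : ∀ n : ℕ, ∃ γ : k, f₁ α - f₂ (γ ^ p ^ n) ∈ N ^ p ^ n := fun n => by
    set β := (iterateFrobeniusEquiv k p n).symm α with hβdef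
    have hβ : β ^ p ^ n = α := by
      rw [← iterateFrobeniusEquiv_def, hβdef, RingEquiv.apply_symm_apply]
    obtain ⟨γ, hγ⟩ := h β
    refine ⟨γ, ?_⟩
    rw [← hβ, map_pow, map_pow, ← sub_pow_expChar_pow]
    exact Ideal.pow_mem_pow hγ _
  choose γ hγ using step
  have hconst : ∀ n, f₂ (γ n ^ p ^ n) = f₂ (γ 0 ^ p ^ 0) := fun n => by
    have h1 : f₂ (γ n ^ p ^ n - γ 0 ^ p ^ 0) ∈ N := by
      have e : f₂ (γ n ^ p ^ n - γ 0 ^ p ^ 0) =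
          (f₁ α - f₂ (γ 0 ^ p ^ 0)) - (f₁ α - f₂ (γ n ^ p ^ n)) := by
        rw [map_sub]; ring
      rw [e]
      refine sub_mem ?_ ?_
      · simpa using hγ 0
      · exact Ideal.pow_le_self (pow_ne_zero n (Fact.out : p.Prime).ne_zero) (hγ n)
    rw [sub_eq_zero.mp (hinj _ h1)]
  refine ⟨γ 0 ^ p ^ 0, ?_⟩
  have hmem : ∀ n, f₁ α - f₂ (γ 0 ^ p ^ 0) ∈ N ^ n := fun n => by
    have := hγ n
    rw [hconst n] at this
    exact Ideal.pow_le_pow_right (Nat.lt_pow_self (Fact.out : p.Prime).one_lt).le this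
  exact (sub_eq_zero.mp (hhaus _ hmem)).symm

/-- Two ring homomorphisms `f₁, f₂ : k → L` from a field with the same image differ by a ring
automorphism `τ` of `k`: `f₂ ∘ τ = f₁`. [folklore] -/
theorem exists_ringEquiv_of_range_eq {k L : Type*} [Field k] [CommRing L] [Nontrivial L]
    (f₁ f₂ : k →+* L) (h : Set.range f₁ = Set.range f₂) :
    ∃ τ : k ≃+* k, ∀ a, f₂ (τ a) = f₁ a := by
  have h12 : ∀ a, ∃ b, f₂ b = f₁ a := fun a => (h ▸ Set.mem_range_self a : f₁ a ∈ Set.range f₂)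
  have h21 : ∀ b, ∃ a, f₁ a = f₂ b := fun b => (h ▸ Set.mem_range_self b : f₂ b ∈ Set.range f₁)
  choose τ hτ using h12
  have hinj := f₂.injective
  let τh : k →+* k :=
    { toFun := τ
      map_one' := hinj (by rw [hτ, map_one, map_one])
      map_mul' := fun a b => hinj (by rw [hτ, map_mul, map_mul, hτ, hτ])
      map_zero' := hinj (by rw [hτ, map_zero, map_zero])
      map_add' := fun a b => hinj (by rw [hτ, map_add, map_add, hτ, hτ]) }
  have hsurj : Function.Surjective τh := fun b => by
    obtain ⟨a, ha⟩ := h21 b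
    exact ⟨a, hinj (show f₂ (τ a) = f₂ b by rw [hτ, ha])⟩
  exact ⟨RingEquiv.ofBijective τh ⟨τh.injective, hsurj⟩, fun a => hτ a⟩

/-! ## Residue fields of closed points over an algebraically closed field -/

/-- **`k → κ(x)` is onto at a closed point** of a scheme locally of finite type over an
algebraically closed field `k` (Hilbert's Nullstellensatz, Mathlib `residueFieldIsoBase`), for
the structure map `k = Γ(Spec k) → Γ(X) → 𝒪_{X,x}`: every germ is congruent to a scalar modulo
`𝔪ₓ`. [folklore] -/
theorem exists_sub_scalar_mem_maximalIdeal {k : Type} [Field k] [IsAlgClosed k] {X : Scheme.{0}}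
    (g : X ⟶ Spec (.of k)) [LocallyOfFiniteType g] (x : X) (hx : IsClosed ({x} : Set X))
    (r : X.presheaf.stalk x) :
    ∃ a : k, r - (X.presheaf.germ ⊤ x trivial).hom
      (g.appTop.hom ((Scheme.ΓSpecIso (.of k)).inv.hom a)) ∈ maximalIdeal (X.presheaf.stalk x) := by
  let e := residueFieldIsoBase g x hx
  have hinv : e.inv = (Scheme.ΓSpecIso (.of k)).inv ≫ g.appTop ≫ X.Γevaluation x := by
    apply Spec.map_injective
    rw [SpecMap_residueFieldIsoBase_inv,
      Literature.AlgebraicGeometry.Motives.Scheme.SpecMap_ΓSpecIso_inv_appTop_Γevaluation g x]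
  refine ⟨e.hom.hom (IsLocalRing.residue _ r), ?_⟩
  rw [← IsLocalRing.residue_eq_zero_iff, map_sub, sub_eq_zero]
  have h1 : e.inv.hom (e.hom.hom (IsLocalRing.residue _ r)) = IsLocalRing.residue _ r := by
    change (e.hom ≫ e.inv).hom _ = _
    rw [e.hom_inv_id]
    rfl
  conv_lhs => rw [← h1]
  rw [hinv]
  rfl

/-! ## The simplicial toric ring `S₀ = k[y]₀`, its irrelevant ideal, and the semilinear twist -/

section Toric

variable {k : Type} [Field k] {d : ℕ} {A : Type} [AddCommGroup A] [DecidableEq A]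
  (deg : Fin d → A)

local notation "S₀" => MvPolynomial.weightedHomogeneousSubmodule k deg 0

local notation "𝔪₀" => RingHom.ker (MvPolynomial.constantCoeff.comp
  (algebraMap (MvPolynomial.weightedHomogeneousSubmodule k deg 0) (MvPolynomial (Fin d) k)))

/-- Membership in the irrelevant ideal `𝔪₀` is the vanishing of the constant coefficient.
[folklore] -/
theorem mem_irrelevant_iff (s : S₀) :
    s ∈ 𝔪₀ ↔ MvPolynomial.constantCoeff (s : MvPolynomial (Fin d) k) = 0 := by
  rw [RingHom.mem_ker, RingHom.comp_apply, SetLike.GradeZero.algebraMap_apply]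

/-- Every element of `S₀` is congruent modulo `𝔪₀` to the scalar given by its constant
coefficient. [folklore] -/
theorem sub_algebraMap_constantCoeff_mem (s : S₀) :
    s - algebraMap k S₀ (MvPolynomial.constantCoeff (s : MvPolynomial (Fin d) k)) ∈ 𝔪₀ := by
  rw [mem_irrelevant_iff, Submodule.coe_sub, map_sub, SetLike.GradeZero.coe_algebraMap,
    MvPolynomial.algebraMap_eq, MvPolynomial.constantCoeff_C, sub_self]

/-- Every element of the completion `𝒞 = (S₀)^_{𝔪₀}` is congruent to a scalar modulo the kernel
of `𝒞 → S₀/𝔪₀`. [folklore] -/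
theorem exists_evalOne_sub_eq_zero (z : AdicCompletion 𝔪₀ S₀) :
    ∃ a : k, AdicCompletion.evalOneₐ 𝔪₀
      (z - algebraMap S₀ (AdicCompletion 𝔪₀ S₀) (algebraMap k S₀ a)) = 0 := by
  obtain ⟨s, hs⟩ := Ideal.Quotient.mk_surjective (AdicCompletion.evalOneₐ 𝔪₀ z)
  refine ⟨MvPolynomial.constantCoeff (s : MvPolynomial (Fin d) k), ?_⟩
  rw [map_sub, ← hs, AdicCompletion.algebraMap_apply, Algebra.algebraMap_self, RingHom.id_apply]
  change Ideal.Quotient.mk _ s - Ideal.Quotient.mk _ _ = 0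
  rw [← map_sub, Ideal.Quotient.eq_zero_iff_mem]
  exact sub_algebraMap_constantCoeff_mem deg s

/-- An element of `𝒞` vanishing in `S₀/𝔪₀` is not a unit (`𝔪₀` is proper: `1 ∉ 𝔪₀`).
[folklore] -/
theorem not_isUnit_of_evalOne_eq_zero {w : AdicCompletion 𝔪₀ S₀}
    (hw : AdicCompletion.evalOneₐ 𝔪₀ w = 0) : ¬ IsUnit w := fun hu => by
  have h1 := hu.map (AdicCompletion.evalOneₐ 𝔪₀)
  rw [hw, isUnit_zero_iff] at h1
  exact (Ideal.Quotient.zero_ne_one_iff.mpr (RingHom.ker_ne_top _)) h1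

omit [DecidableEq A] in
/-- `MvPolynomial.map` preserves weighted homogeneity (the support can only shrink).
[folklore] -/
theorem isWeightedHomogeneous_map (σ : k →+* k) {φ : MvPolynomial (Fin d) k} {m : A}
    (hφ : φ.IsWeightedHomogeneous deg m) :
    (MvPolynomial.map σ φ).IsWeightedHomogeneous deg m := by
  intro c hc
  rw [MvPolynomial.coeff_map] at hc
  exact hφ fun h0 => hc (by rw [h0, map_zero])

/-- `map σ⁻¹ (map σ φ) = φ` for a ring automorphism `σ` of the coefficients. [folklore] -/
theorem map_symm_map (σ : k ≃+* k) (φ : MvPolynomial (Fin d) k) :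
    MvPolynomial.map (σ.symm : k →+* k) (MvPolynomial.map (σ : k →+* k) φ) = φ := by
  rw [MvPolynomial.map_map, RingEquiv.symm_comp, MvPolynomial.map_id]

/-- **The semilinear twist** of the simplicial toric ring: a ring automorphism `σ` of `k` acts
coefficientwise on `S = k[y₁, …, y_d]` preserving the degree-`0` part `S₀`, giving a RING
automorphism `Ψ` of `S₀` (which is `σ`-semilinear over `k`). [folklore] -/
theorem exists_twist (σ : k ≃+* k) :
    ∃ Ψ : S₀ ≃+* S₀, ∀ s : S₀, (Ψ s).1 = MvPolynomial.map (σ : k →+* k) s.1 := by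
  refine ⟨
    { toFun := fun s => ⟨MvPolynomial.map (σ : k →+* k) (s : MvPolynomial (Fin d) k),
        isWeightedHomogeneous_map deg _ s.2⟩
      invFun := fun s => ⟨MvPolynomial.map (σ.symm : k →+* k) (s : MvPolynomial (Fin d) k),
        isWeightedHomogeneous_map deg _ s.2⟩
      left_inv := fun s => Subtype.ext (map_symm_map σ (s : MvPolynomial (Fin d) k))
      right_inv := fun s => Subtype.ext (by
        have h := map_symm_map σ.symm (s : MvPolynomial (Fin d) k)
        rw [RingEquiv.symm_symm] at h
        exact h)
      map_mul' := fun a b => Subtype.ext (by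
        change MvPolynomial.map _ ((a * b : S₀) : MvPolynomial (Fin d) k) = _
        rw [SetLike.GradeZero.coe_mul, map_mul]
        rfl)
      map_add' := fun a b => Subtype.ext (by
        change MvPolynomial.map _ ((a + b : S₀) : MvPolynomial (Fin d) k) = _
        rw [Submodule.coe_add, map_add]
        rfl) }, fun _ => rfl⟩

variable {deg} in
/-- A twist (`Ψ` acting as `map σ` on polynomials) acts on scalars through `σ`. [folklore] -/
theorem twist_algebraMap {σ : k ≃+* k} {Ψ : S₀ ≃+* S₀}
    (hΨ : ∀ s : S₀, (Ψ s).1 = MvPolynomial.map (σ : k →+* k) s.1) (b : k) :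
    Ψ (algebraMap k S₀ b) = algebraMap k S₀ (σ b) := by
  refine Subtype.ext ?_
  rw [hΨ, SetLike.GradeZero.coe_algebraMap, SetLike.GradeZero.coe_algebraMap,
    MvPolynomial.algebraMap_eq, MvPolynomial.map_C]
  rfl

variable {deg} in
/-- A twist preserves the irrelevant ideal (elementwise). [folklore] -/
theorem twist_mem_irrelevant {σ : k ≃+* k} {Ψ : S₀ ≃+* S₀}
    (hΨ : ∀ s : S₀, (Ψ s).1 = MvPolynomial.map (σ : k →+* k) s.1) {s : S₀} (hs : s ∈ 𝔪₀) :
    Ψ s ∈ 𝔪₀ := by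
  rw [mem_irrelevant_iff] at hs ⊢
  rw [hΨ, MvPolynomial.constantCoeff_map, hs, map_zero]

variable {deg} in
/-- The inverse of a twist preserves the irrelevant ideal (elementwise). [folklore] -/
theorem twist_symm_mem_irrelevant {σ : k ≃+* k} {Ψ : S₀ ≃+* S₀}
    (hΨ : ∀ s : S₀, (Ψ s).1 = MvPolynomial.map (σ : k →+* k) s.1) {s : S₀} (hs : s ∈ 𝔪₀) :
    Ψ.symm s ∈ 𝔪₀ := by
  rw [mem_irrelevant_iff] at hs ⊢
  have h := congrArg MvPolynomial.constantCoeff (hΨ (Ψ.symm s))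
  rw [Ψ.apply_symm_apply, MvPolynomial.constantCoeff_map, hs] at h
  exact (map_eq_zero_iff _ σ.injective).mp h.symm

variable {deg} in
/-- A twist preserves the irrelevant ideal: `Ψ(𝔪₀) = 𝔪₀`. [folklore] -/
theorem map_twist_irrelevant {σ : k ≃+* k} {Ψ : S₀ ≃+* S₀}
    (hΨ : ∀ s : S₀, (Ψ s).1 = MvPolynomial.map (σ : k →+* k) s.1) :
    Ideal.map Ψ.toRingHom 𝔪₀ = 𝔪₀ := by
  refine le_antisymm ?_ fun s hs => ?_
  · rw [Ideal.map_le_iff_le_comap]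
    intro s hs
    exact twist_mem_irrelevant hΨ hs
  · have h1 : s = Ψ.toRingHom (Ψ.symm s) := (Ψ.apply_symm_apply s).symm
    rw [h1]
    exact Ideal.mem_map_of_mem _ (twist_symm_mem_irrelevant hΨ hs)

variable {deg} in
/-- **The completed twist** `Ψ̂ : 𝒞 ≃ 𝒞` (transport of the `𝔪₀`-adic completion along a twist
`Ψ`, `Literature.AlgebraicGeometry.Resolution.adicCompletionCongr`) acts on scalars through `σ`.
[folklore] -/
theorem adicCompletionCongr_twist_algebraMap {σ : k ≃+* k} {Ψ : S₀ ≃+* S₀}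
    (hΨ : ∀ s : S₀, (Ψ s).1 = MvPolynomial.map (σ : k →+* k) s.1) (b : k) :
    adicCompletionCongr 𝔪₀ 𝔪₀ Ψ (map_twist_irrelevant hΨ)
        (algebraMap S₀ (AdicCompletion 𝔪₀ S₀) (algebraMap k S₀ b)) =
      algebraMap S₀ (AdicCompletion 𝔪₀ S₀) (algebraMap k S₀ (σ b)) := by
  rw [AdicCompletion.algebraMap_apply, Algebra.algebraMap_self, RingHom.id_apply,
    adicCompletionCongr_of, twist_algebraMap hΨ, AdicCompletion.algebraMap_apply,
    Algebra.algebraMap_self, RingHom.id_apply]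

/-! ## The theorem (inside the toric section, with the notations `S₀`, `𝔪₀`) -/

/-- `k`-linearisation, working form of `stub_kLinearisation` (see there). [folklore] -/
theorem kLinearisation_aux {p : ℕ} [Fact p.Prime] [CharP k p] [IsAlgClosed k] {X : Scheme.{0}}
    (g : X ⟶ Spec (.of k)) [LocallyOfFiniteType g] (x : X) (hx : IsClosed ({x} : Set X))
    (E₁ : AdicCompletion (maximalIdeal (X.presheaf.stalk x)) (X.presheaf.stalk x) ≃+*
      AdicCompletion 𝔪₀ S₀) :
    ∃ E₂ : AdicCompletion (maximalIdeal (X.presheaf.stalk x)) (X.presheaf.stalk x) ≃+*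
        AdicCompletion 𝔪₀ S₀,
      ∀ a : k,
        E₂ (algebraMap _ _ ((X.presheaf.germ ⊤ x trivial).hom
            (g.appTop.hom ((Scheme.ΓSpecIso (.of k)).inv.hom a)))) =
          algebraMap S₀ _ (algebraMap k S₀ a) := by
  haveI : IsLocallyNoetherian X := LocallyOfFiniteType.isLocallyNoetherian g
  -- the two structure maps `f₁ = (k → 𝒪_{X,x} → Ô)` and `f₂ = E₁⁻¹ ∘ (k → S₀ → 𝒞)`
  let ι : k →+* X.presheaf.stalk x :=
    (X.presheaf.germ ⊤ x trivial).hom.comp (g.appTop.hom.comp (Scheme.ΓSpecIso (.of k)).inv.hom)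
  let f₁ : k →+* AdicCompletion (maximalIdeal (X.presheaf.stalk x)) (X.presheaf.stalk x) :=
    (algebraMap (X.presheaf.stalk x) _).comp ι
  let ι𝒞 : k →+* AdicCompletion 𝔪₀ S₀ := (algebraMap S₀ _).comp (algebraMap k S₀)
  let f₂ : k →+* AdicCompletion (maximalIdeal (X.presheaf.stalk x)) (X.presheaf.stalk x) :=
    E₁.symm.toRingHom.comp ι𝒞
  have hf₁ : ∀ a, f₁ a = algebraMap (X.presheaf.stalk x) _ (ι a) := fun a => rfl
  have hf₂ : ∀ a, f₂ a = E₁.symm (ι𝒞 a) := fun a => rfl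
  -- (1a) every element of `Ô` is a scalar modulo `𝔪̂`, for `f₁`
  have hres1 : ∀ y, ∃ a : k, y - f₁ a ∈ maximalIdeal _ := fun y => by
    obtain ⟨q, hq⟩ :=
      (AdicCompletion.residueField_map_bijective (X.presheaf.stalk x)).2 (IsLocalRing.residue _ y)
    obtain ⟨r, rfl⟩ := IsLocalRing.residue_surjective q
    obtain ⟨a, ha⟩ := exists_sub_scalar_mem_maximalIdeal g x hx r
    refine ⟨a, ?_⟩
    rw [← IsLocalRing.residue_eq_zero_iff, map_sub, sub_eq_zero, ← hq, hf₁,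
      ← IsLocalRing.ResidueField.map_residue]
    rw [← IsLocalRing.residue_eq_zero_iff, map_sub, sub_eq_zero] at ha
    exact congrArg _ ha
  -- (1b) every element of `Ô` is a scalar modulo `𝔪̂`, for `f₂`
  have hres2 : ∀ y, ∃ a : k, y - f₂ a ∈ maximalIdeal _ := fun y => by
    obtain ⟨a, ha⟩ := exists_evalOne_sub_eq_zero deg (E₁ y)
    refine ⟨a, ?_⟩
    rw [IsLocalRing.mem_maximalIdeal, mem_nonunits_iff]
    refine fun hu => not_isUnit_of_evalOne_eq_zero deg ha ?_
    have h2 := hu.map E₁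
    rwa [map_sub, hf₂, E₁.apply_symm_apply] at h2
  -- (2) the two copies of `k` in `Ô` coincide: `E₁ ∘ f₁ = ι_𝒞 ∘ τ`
  have hN := (maximalIdeal.isMaximal
    (AdicCompletion (maximalIdeal (X.presheaf.stalk x)) (X.presheaf.stalk x))).ne_top
  have hhaus : ∀ z : AdicCompletion (maximalIdeal (X.presheaf.stalk x)) (X.presheaf.stalk x),
      (∀ n : ℕ, z ∈ maximalIdeal _ ^ n) → z = 0 := fun z hz => by
    refine IsHausdorff.haus'
      (I := maximalIdeal (AdicCompletion (maximalIdeal (X.presheaf.stalk x)) (X.presheaf.stalk x)))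
      z fun n => by rw [SModEq.zero, smul_eq_mul, Ideal.mul_top]; exact hz n
  have hrange : Set.range f₁ = Set.range f₂ := le_antisymm
    (range_subset_range_of_forall_sub_mem (p := p) _ hN hhaus f₁ f₂ fun a => hres2 (f₁ a))
    (range_subset_range_of_forall_sub_mem (p := p) _ hN hhaus f₂ f₁ fun a => hres1 (f₂ a))
  obtain ⟨τ, hτ⟩ := exists_ringEquiv_of_range_eq f₁ f₂ hrange
  have hE₁ : ∀ a : k, E₁ (f₁ a) = ι𝒞 (τ a) := fun a => by
    rw [← hτ a, hf₂]
    exact E₁.apply_symm_apply _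
  -- (3) the twist by `τ⁻¹`
  obtain ⟨Ψ, hΨ⟩ := exists_twist deg τ.symm
  refine ⟨E₁.trans (adicCompletionCongr 𝔪₀ 𝔪₀ Ψ (map_twist_irrelevant hΨ)), fun a => ?_⟩
  rw [RingEquiv.trans_apply]
  change adicCompletionCongr 𝔪₀ 𝔪₀ Ψ (map_twist_irrelevant hΨ) (E₁ (f₁ a)) = _
  rw [hE₁]
  change adicCompletionCongr 𝔪₀ 𝔪₀ Ψ (map_twist_irrelevant hΨ)
    (algebraMap S₀ _ (algebraMap k S₀ (τ a))) = _
  rw [adicCompletionCongr_twist_algebraMap hΨ, RingEquiv.symm_apply_apply]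

end Toric

/-! ## The registered statement -/

/-- **`k`-linearisation** (folklore — uniqueness of the coefficient field of a Hausdorff local
ring of characteristic `p` with perfect residue field, Cohen / Matsumura §28): over an
algebraically closed field `k` of characteristic `p`, if the completed local ring of a finite-type
`k`-scheme `X` at a CLOSED point is RING-isomorphic to the completed simplicial toric ring
`AdicCompletion 𝔪₀ S₀`, then it is so compatibly with the two `k`-structures: the image of `k`
is a perfect coefficient field of the target, hence equals the standard one up to an automorphism
`τ` of `k`, and twisting by the `τ`-semilinear automorphism of `S₀ = k[y]₀` (coefficientwise
`τ⁻¹`; `S₀` and `𝔪₀` are defined over the prime field) corrects it. [folklore] -/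
theorem stub_kLinearisation {p : ℕ} [Fact p.Prime] {k : Type} [Field k] [CharP k p]
    [IsAlgClosed k] (X : Scheme.{0}) (g : X ⟶ Spec (.of k)) [LocallyOfFiniteType g]
    [QuasiCompact g] (x : X) (hx : IsClosed ({x} : Set X))
    (d : ℕ) (A : Type) [AddCommGroup A] [Finite A] [DecidableEq A] (deg : Fin d → A)
    (E₁ : AdicCompletion (maximalIdeal (X.presheaf.stalk x)) (X.presheaf.stalk x) ≃+*
      AdicCompletion
        (RingHom.ker (MvPolynomial.constantCoeff.comp
          (algebraMap (MvPolynomial.weightedHomogeneousSubmodule k deg 0)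
            (MvPolynomial (Fin d) k))))
        (MvPolynomial.weightedHomogeneousSubmodule k deg 0)) :
    ∃ E₂ : AdicCompletion (maximalIdeal (X.presheaf.stalk x)) (X.presheaf.stalk x) ≃+*
        AdicCompletion
          (RingHom.ker (MvPolynomial.constantCoeff.comp
            (algebraMap (MvPolynomial.weightedHomogeneousSubmodule k deg 0)
              (MvPolynomial (Fin d) k))))
          (MvPolynomial.weightedHomogeneousSubmodule k deg 0),
      ∀ a : k,
        E₂ (algebraMap _ _ ((X.presheaf.germ ⊤ x trivial).hom
            (g.appTop.hom ((Scheme.ΓSpecIso (.of k)).inv.hom a)))) =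
          algebraMap (MvPolynomial.weightedHomogeneousSubmodule k deg 0) _
            (algebraMap k (MvPolynomial.weightedHomogeneousSubmodule k deg 0) a) := by
  exact kLinearisation_aux deg g x hx E₁

end Summit.ResolutionOfSingularities.ResolutionOfSingularities.Theorems.TeissierResolve.KLinearisation

end
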